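import Literature.NumberTheory.Sieve.BombieriFriedlanderIwaniecAssembly
import Literature.NumberTheory.Sieve.ShiuBrunTitchmarshProofs
import Literature.NumberTheory.Sieve.ShiuTheoremProofs
import Literature.NumberTheory.Sieve.SieveFrameworkFundamentalLemma
import Literature.NumberTheory.LFunctions.SiegelWalfiszMoebiusProofs
import Literature.NumberTheory.LFunctions.PrimeNumberTheoremErrorTermProofs
import HarnessLib

/-!
# BFI 1986, Theorem 10 (`bfi_wellFactorable_level`): the decomposition record over its deep leaves

Topic `Literature/NumberTheory/Sieve`. Decomposition (librarian `fact-decompose`, 2026-08-16) of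
the XL named fact `Literature.NumberTheory.Sieve.bfi_wellFactorable_level` (`LevelOfDistribution.lean`;
Bombieri–Friedlander–Iwaniec, Acta Math. 156 (1986), Thm. 10: the primes have well-factorable level
`x^{4/7−ε}`).

The tree's assembly `bfi_wellFactorable_level_of_leaves` (`BombieriFriedlanderIwaniecAssembly.lean`:
dyadic and sifted reduction, Heath-Brown's identity, partition into box tuples, §15 skeleton, §17
dispatch) consumes nine named facts. Five of them — the classical inputs — are by now THEOREMS of
the tree: `BombieriFriedlanderIwaniecLemma3_holds` (`ShiuBrunTitchmarshProofs.lean`),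
`Shiu1980BrunTitchmarsh_holds` (`ShiuTheoremProofs.lean`), `LFunctions.SiegelWalfiszMoebius_holds`
(`SiegelWalfiszMoebiusProofs.lean`), `SieveSequence.fundamental_lemma_uniform_holds`
(`SieveFrameworkFundamentalLemma.lean`), `LFunctions.ChebyshevPsiDeLaValleePoussin_holds`
(`PrimeNumberTheoremErrorTermProofs.lean`). What remains are the four deep printed theorems of the
source (dispersion method; Deshouillers–Iwaniec bounds for sums of Kloosterman sums), all EXISTING
named facts:

* `BombieriFriedlanderIwaniecTheorem1` (BFI Thm. 1; `BombieriFriedlanderIwaniecDispersion.lean`),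
* `BombieriFriedlanderIwaniecTheorem2` (BFI Thm. 2; ibid.),
* `BombieriFriedlanderIwaniecTheorem0b` (BFI Thm. 0 (b); `BombieriFriedlanderIwaniecBilinear.lean`),
* `BombieriFriedlanderIwaniecTheorem5StarInterval` (BFI Thm. 5*, interval form; ibid.).

`bfi_wellFactorable_level_holds_of` records exactly this; no new fact, theorems only.

## References

* E. Bombieri, J. B. Friedlander, H. Iwaniec, *Primes in arithmetic progressions to large moduli*,
  Acta Math. 156 (1986) 203–251: Thm. 0, Thms. 1–2, Thm. 5*, Lemma 3, §15, §17, Thm. 10 (p. 209).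
  [BombieriFriedlanderIwaniecActa1986]
* P. Shiu, J. reine angew. Math. 313 (1980), Thm. 1. [Shiu1980]
-/

namespace Literature.NumberTheory.Sieve

/-- **BFI Theorem 10 from its four deep printed leaves** (Thms. 1, 2, 0 (b), 5* of the source), the
five classical leaves of `bfi_wellFactorable_level_of_leaves` being supplied by their discharges.
The decomposition assembly of `bfi_wellFactorable_level`.
[cite: BombieriFriedlanderIwaniecActa1986, Theorem 10 (proof, §§15–17)] -/
theorem bfi_wellFactorable_level_holds_of :
    BombieriFriedlanderIwaniecTheorem1 → BombieriFriedlanderIwaniecTheorem2 →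
      BombieriFriedlanderIwaniecTheorem0b → BombieriFriedlanderIwaniecTheorem5StarInterval →
        bfi_wellFactorable_level :=
  fun h1 h2 h0b h5 ↦
    bfi_wellFactorable_level_of_leaves h1 h2 h0b h5 BombieriFriedlanderIwaniecLemma3_holds
      Shiu1980BrunTitchmarsh_holds LFunctions.SiegelWalfiszMoebius_holds
      SieveSequence.fundamental_lemma_uniform_holds LFunctions.ChebyshevPsiDeLaValleePoussin_holds

end Literature.NumberTheory.Sieve
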